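import Mathlib
import Literature.Analysis.Calculus.ConvexQuadrature
import Literature.NumberTheory.LFunctions.DhirInequalities
import HarnessLib

/-!
# The weighted power sums `∑_{r<q} (1 - r/q) r^s ≤ q^{1+s}/((1+s)(2+s))` for real `-1 < s ≤ 1`, `s ≠ 0`

Topic `Literature/NumberTheory/LFunctions`. The inequality
`∑_{r=1}^{q} (1 - r/q) r^s ≤ q^{1+s}/((1+s)(2+s))` (`-1 < s ≤ 1`, `q ≥ 1` an integer), the display
`(dhir_inequality)` in the proof of Lemma 2.4 of A. Yang, J. Math. Anal. Appl. 534 (2024) =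
arXiv:2301.03165 (credited to Patel 2022, (32), `-1 < s < 1`, and Hiary 2016, (45), `s = 1`), also
eq. (3.21) of Patel–Yang, J. Number Theory 262 (2024). `DhirInequalities.lean` proves the cases
`s = 1, ±1/2` by elementary means; here the general case is PROVED by comparison with
`∫_0^q (1 - x/q) x^s dx = q^{1+s}/((1+s)(2+s))`: for `0 < s ≤ 1` the integrand is concave on
`[0, ∞)` and the trapezoid rule underestimates the integral (the tree's
`Literature.Analysis.Calculus.convexOn_integral_le_trapezoid`); for `-1 < s < 0` it is decreasing on
`(0, q]` and the right-endpoint rule underestimates it. The explicit `k`-th derivative tests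
(Yang, Lemma 2.5) use `s = ±1/(2J - 2)`.

## Main results

* `Literature.NumberTheory.LFunctions.VdC.integral_dhir` — `∫_0^c (1 - x/q) x^s dx = c^{1+s}/(1+s) - c^{2+s}/((2+s)q)`.
* `Literature.NumberTheory.LFunctions.VdC.dhir_rpow_pos` — the inequality for `0 < s ≤ 1`.
* `Literature.NumberTheory.LFunctions.VdC.dhir_rpow_neg` — the inequality for `-1 < s < 0`.

## References

* A. Yang, *Explicit bounds on `ζ(s)` in the critical strip and a zero-free region*, J. Math.
  Anal. Appl. 534 (2024) 128124 = arXiv:2301.03165v3, proof of Lemma 2.4. [cite: Yang2024, Lemma 2.4 (proof)]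
* D. Patel, A. Yang, *An explicit sub-Weyl bound for `ζ(1/2 + it)`*, J. Number Theory 262 (2024),
  eq. (3.21). [cite: PatelYang2024, (3.21)]
-/

noncomputable section

open Finset Real MeasureTheory intervalIntegral Set

namespace Literature.NumberTheory.LFunctions
namespace VdC

/-! ### The integral -/

/-- Interval integrability of the weighted power `(1 - x/q) x^s`, `s > -1`. [folklore] -/
theorem intervalIntegrable_dhir {s : ℝ} (hs : -1 < s) (q a b : ℝ) :
    IntervalIntegrable (fun x : ℝ => (1 - x / q) * x ^ s) volume a b := by
  have h1 : IntervalIntegrable (fun x : ℝ => x ^ s) volume a b := intervalIntegrable_rpow' hs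
  have h2 : IntervalIntegrable (fun x : ℝ => x ^ (s + 1)) volume a b :=
    intervalIntegrable_rpow' (by linarith)
  have h3 : IntervalIntegrable (fun x : ℝ => x ^ s - x ^ (s + 1) / q) volume a b :=
    h1.sub (h2.div_const q)
  refine h3.congr ?_
  · intro x _
    -- `x^{s+1} = x^s · x` also for `x < 0` with Lean's conventions? only use `x ≥ 0`? we avoid:
    -- the identity `(1 - x/q) x^s = x^s - x^{s+1}/q` holds for all real `x` by `rpow_add_one'`
    -- when `x ≥ 0`, and for `x < 0` by `Real.rpow_def_of_neg`; we use the general `rpow_add_one`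
    -- for `x ≠ 0` and the case `x = 0` directly.
    show x ^ s - x ^ (s + 1) / q = (1 - x / q) * x ^ s
    rcases eq_or_ne x 0 with rfl | hx
    · have : (0 : ℝ) ^ (s + 1) = 0 := Real.zero_rpow (by linarith)
      rw [this]; ring
    · rw [Real.rpow_add_one hx]; ring

/-- `∫_0^c (1 - x/q) x^s dx = c^{1+s}/(1+s) - c^{2+s}/((2+s) q)` for `s > -1`. [folklore] -/
theorem integral_dhir {s : ℝ} (hs : -1 < s) (q c : ℝ) :
    ∫ x in (0 : ℝ)..c, (1 - x / q) * x ^ s = c ^ (1 + s) / (1 + s) - c ^ (2 + s) / ((2 + s) * q) := by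
  have hs1 : s + 1 ≠ 0 := by linarith
  have hs2 : s + 2 ≠ 0 := by linarith
  have heq : ∀ x ∈ uIcc (0 : ℝ) c, (1 - x / q) * x ^ s = x ^ s - x ^ (s + 1) / q := by
    intro x _
    rcases eq_or_ne x 0 with rfl | hx
    · have : (0 : ℝ) ^ (s + 1) = 0 := Real.zero_rpow hs1
      rw [this]; ring
    · rw [Real.rpow_add_one hx]; ring
  rw [intervalIntegral.integral_congr heq,
    intervalIntegral.integral_sub (intervalIntegrable_rpow' hs) ((intervalIntegrable_rpow' (by linarith)).div_const q),
    intervalIntegral.integral_div, integral_rpow (Or.inl hs), integral_rpow (Or.inl (by linarith))]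
  rw [Real.zero_rpow hs1, Real.zero_rpow (by linarith : s + 1 + 1 ≠ 0)]
  have e1 : (1 : ℝ) + s = s + 1 := by ring
  have e2 : (2 : ℝ) + s = s + 1 + 1 := by ring
  rw [e1, e2]
  field_simp
  ring

/-- The total integral: `∫_0^q (1 - x/q) x^s dx = q^{1+s}/((1+s)(2+s))` (`q > 0`). [folklore] -/
theorem integral_dhir_total {s : ℝ} (hs : -1 < s) {q : ℝ} (hq : 0 < q) :
    ∫ x in (0 : ℝ)..q, (1 - x / q) * x ^ s = q ^ (1 + s) / ((1 + s) * (2 + s)) := by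
  rw [integral_dhir hs q q]
  have h2 : q ^ (2 + s) = q ^ (1 + s) * q := by
    rw [show (2 : ℝ) + s = (1 + s) + 1 by ring, Real.rpow_add_one hq.ne']
  rw [h2]
  have hs1 : (1 : ℝ) + s ≠ 0 := by linarith
  have hs2 : (2 : ℝ) + s ≠ 0 := by linarith
  field_simp
  ring

/-! ### `0 < s ≤ 1`: concavity and the trapezoid rule -/

/-- For `0 < s ≤ 1` and `q > 0`, `x ↦ x^{s+1}/q - x^s` is convex on `[0, ∞)`. [folklore] -/
theorem convexOn_neg_dhir {s : ℝ} (hs0 : 0 < s) (hs1 : s ≤ 1) {q : ℝ} (hq : 0 < q) :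
    ConvexOn ℝ (Ici (0 : ℝ)) (fun x : ℝ => x ^ (s + 1) / q - x ^ s) := by
  have h1 : ConvexOn ℝ (Ici (0 : ℝ)) (fun x : ℝ => (1 / q) • x ^ (s + 1)) :=
    (convexOn_rpow (by linarith : (1 : ℝ) ≤ s + 1)).smul (by positivity)
  have h2 : ConvexOn ℝ (Ici (0 : ℝ)) (fun x : ℝ => -(x ^ s)) :=
    (Real.concaveOn_rpow hs0.le hs1).neg
  have h3 := h1.add h2
  refine h3.congr ?_
  intro x _
  simp only [Pi.add_apply, smul_eq_mul]
  ring

/-- **The weighted power sum for `0 < s ≤ 1`**: `∑_{r=1}^{q-1} (1 - r/q) r^s ≤ q^{1+s}/((1+s)(2+s))`.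
[cite: Yang2024, Lemma 2.4 (proof)] -/
theorem dhir_rpow_pos {s : ℝ} (hs0 : 0 < s) (hs1 : s ≤ 1) (q : ℕ) (hq : 1 ≤ q) :
    ∑ r ∈ Finset.Ico 1 q, (1 - (r : ℝ) / q) * (r : ℝ) ^ s ≤ (q : ℝ) ^ (1 + s) / ((1 + s) * (2 + s)) := by
  have hqpos : (0 : ℝ) < q := by exact_mod_cast hq
  have hs : -1 < s := by linarith
  set φ : ℝ → ℝ := fun x => (1 - x / q) * x ^ s with hφ
  set Φ : ℕ → ℝ := fun r => ∫ x in (0 : ℝ)..r, φ x with hΦ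
  have h := sum_Ico_le_of_trapezoid (fun r : ℕ => φ r) Φ q ?_ ?_ ?_
  · have e : Φ q - Φ 0 = (q : ℝ) ^ (1 + s) / ((1 + s) * (2 + s)) := by
      simp only [hΦ, Nat.cast_zero, intervalIntegral.integral_same, sub_zero]
      exact integral_dhir_total hs hqpos
    linarith
  · simp only [hφ, Nat.cast_zero, Real.zero_rpow hs0.ne', mul_zero]
  · simp only [hφ]; rw [div_self hqpos.ne']; ring
  · intro r hr1 hrq
    have hr : ((r - 1 : ℕ) : ℝ) = (r : ℝ) - 1 := by rw [Nat.cast_sub hr1]; simp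
    have hr0 : (0 : ℝ) ≤ (r : ℝ) - 1 := by
      have : (1 : ℝ) ≤ r := by exact_mod_cast hr1
      linarith
    -- trapezoid for the convex function `-φ` on `[r-1, r]`
    have hconv := convexOn_neg_dhir hs0 hs1 hqpos
    have htrap := Literature.Analysis.Calculus.convexOn_integral_le_trapezoid hconv
      (a := (r : ℝ) - 1) (b := (r : ℝ)) (by exact hr0) (by exact (Nat.cast_nonneg r : (0:ℝ) ≤ r))
      (by linarith) ((intervalIntegrable_rpow' (by linarith)).div_const _ |>.sub (intervalIntegrable_rpow' hs))
    -- identify `-φ`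
    have hneg : ∀ x : ℝ, 0 ≤ x → x ^ (s + 1) / q - x ^ s = -φ x := by
      intro x hx
      simp only [hφ]
      rcases eq_or_ne x 0 with rfl | hx0
      · rw [Real.zero_rpow (by linarith), Real.zero_rpow hs0.ne']; ring
      · rw [Real.rpow_add_one hx0]; ring
    have hint : ∫ x in ((r : ℝ) - 1)..r, (x ^ (s + 1) / q - x ^ s) = -∫ x in ((r : ℝ) - 1)..r, φ x := by
      rw [← intervalIntegral.integral_neg]
      refine intervalIntegral.integral_congr fun x hx => ?_
      rw [Set.uIcc_of_le (by linarith)] at hx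
      exact hneg x (hr0.trans hx.1)
    rw [hint, hneg _ hr0, hneg _ (Nat.cast_nonneg r)] at htrap
    -- `Φ r - Φ (r-1) = ∫_{r-1}^r φ`
    have hstep : Φ r - Φ (r - 1) = ∫ x in ((r : ℝ) - 1)..r, φ x := by
      simp only [hΦ]
      rw [hr]
      exact intervalIntegral.integral_interval_sub_left (intervalIntegrable_dhir hs _ _ _)
        (intervalIntegrable_dhir hs _ _ _)
    rw [hstep]
    show (φ ((r - 1 : ℕ) : ℝ) + φ r) / 2 ≤ ∫ x in ((r : ℝ) - 1)..r, φ x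
    rw [hr]
    linarith

/-! ### `-1 < s < 0`: monotonicity and the right-endpoint rule -/

/-- For `s ≤ 0`, `q > 0`: `(1 - x/q) x^s` is nonincreasing in `x ∈ (0, q]`. [folklore] -/
theorem dhir_antitone {s : ℝ} (hs0 : s ≤ 0) {q x y : ℝ} (hx : 0 < x) (hxy : x ≤ y) (hy : y ≤ q)
    (hq : 0 < q) : (1 - y / q) * y ^ s ≤ (1 - x / q) * x ^ s := by
  have h1 : y ^ s ≤ x ^ s := Real.rpow_le_rpow_of_nonpos hx hxy hs0
  have h2 : 1 - y / q ≤ 1 - x / q := by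
    have := div_le_div_of_nonneg_right hxy hq.le; linarith
  have h3 : 0 ≤ 1 - y / q := by rw [sub_nonneg, div_le_one hq]; exact hy
  have h4 : 0 ≤ x ^ s := Real.rpow_nonneg hx.le _
  exact mul_le_mul h2 h1 (Real.rpow_nonneg (hx.le.trans hxy) _) (by linarith)

/-- **The weighted power sum for `-1 < s < 0`**: `∑_{r=1}^{q-1} (1 - r/q) r^s ≤ q^{1+s}/((1+s)(2+s))`.
[cite: Yang2024, Lemma 2.4 (proof)] -/
theorem dhir_rpow_neg {s : ℝ} (hs : -1 < s) (hs0 : s < 0) (q : ℕ) (hq : 1 ≤ q) :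
    ∑ r ∈ Finset.Ico 1 q, (1 - (r : ℝ) / q) * (r : ℝ) ^ s ≤ (q : ℝ) ^ (1 + s) / ((1 + s) * (2 + s)) := by
  have hqpos : (0 : ℝ) < q := by exact_mod_cast hq
  set φ : ℝ → ℝ := fun x => (1 - x / q) * x ^ s with hφ
  set Ψ : ℕ → ℝ := fun r => ∫ x in (0 : ℝ)..r, φ x with hΨ
  have h := sum_Ico_le_of_left (fun r : ℕ => φ r) Ψ q ?_ ?_
  · have e : Ψ q - Ψ 0 = (q : ℝ) ^ (1 + s) / ((1 + s) * (2 + s)) := by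
      simp only [hΨ, Nat.cast_zero, intervalIntegral.integral_same, sub_zero]
      exact integral_dhir_total hs hqpos
    linarith
  · simp only [hφ]; rw [div_self hqpos.ne']; ring
  · intro r hr1 hrq
    have hr : ((r - 1 : ℕ) : ℝ) = (r : ℝ) - 1 := by rw [Nat.cast_sub hr1]; simp
    have hr0 : (0 : ℝ) ≤ (r : ℝ) - 1 := by
      have : (1 : ℝ) ≤ r := by exact_mod_cast hr1
      linarith
    have hrq' : (r : ℝ) ≤ q := by exact_mod_cast hrq
    have hstep : Ψ r - Ψ (r - 1) = ∫ x in ((r : ℝ) - 1)..r, φ x := by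
      simp only [hΨ]
      rw [hr]
      exact intervalIntegral.integral_interval_sub_left (intervalIntegrable_dhir hs _ _ _)
        (intervalIntegrable_dhir hs _ _ _)
    rw [hstep]
    show φ r ≤ ∫ x in ((r : ℝ) - 1)..r, φ x
    rcases eq_or_lt_of_le hr1 with hr1' | hr2
    · -- `r = 1`: compute the integral
      subst hr1'
      simp only [Nat.cast_one, sub_self]
      rw [integral_dhir hs q 1, Real.one_rpow, Real.one_rpow]
      simp only [hφ, Real.one_rpow, mul_one]
      have h1 : (1 : ℝ) ≤ 1 / (1 + s) := by
        rw [le_div_iff₀ (by linarith)]; linarith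
      have h2 : 1 / ((2 + s) * q) ≤ 1 / q := by
        apply one_div_le_one_div_of_le hqpos; nlinarith
      have e3 : (1 : ℝ) - 1 / q = 1 - 1 / q := rfl
      linarith
    · -- `r ≥ 2`: `φ` is nonincreasing on `[r-1, r] ⊆ [1, q]`
      have hr1r : (1 : ℝ) ≤ (r : ℝ) - 1 := by
        have : (2 : ℝ) ≤ r := by exact_mod_cast hr2
        linarith
      have hmono : ∀ x ∈ Icc ((r : ℝ) - 1) r, φ r ≤ φ x := fun x hx =>
        dhir_antitone hs0.le (by linarith [hx.1]) hx.2 hrq' hqpos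
      have hconst : ∫ _ in ((r : ℝ) - 1)..r, φ r = φ r := by
        rw [intervalIntegral.integral_const]; simp
      rw [← hconst]
      exact intervalIntegral.integral_mono_on (by linarith) intervalIntegrable_const
        (intervalIntegrable_dhir hs _ _ _) hmono

end VdC
end Literature.NumberTheory.LFunctions
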